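import Literature.MathematicalPhysics.QuantumFieldTheory.Balaban1983to89.B9Eq326LocalPartZerothOrderWeightedRow
import Literature.MathematicalPhysics.QuantumFieldTheory.Balaban1983to89.B9Eq316PenaltyLocalLetter
import Literature.MathematicalPhysics.QuantumFieldTheory.Balaban1983to89.B9Eq342GradientRowNaturalPerturbation
import Literature.MathematicalPhysics.QuantumFieldTheory.Balaban1983to89.B9Eq342CoshWeightBlockDistance

/-!
# `Balaban1983to89.B9Eq326LocalPartZerothOrderCoshRow` — T. Bałaban, *Propagators for lattice gauge theories in a background field*, Commun. Math. Phys.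
# **99** (1985) 389–434 [Balaban1985BackgroundPropagators] (3.26) p. 395 (the local part `A₀ = Δ(U) + D_UD*_U + Q*aQ`), (3.69) p. 404 (the weighted
# sup-norm step), (3.16) p. 393, (3.10)–(3.11) p. 392, with [Balaban1985Variational] (134)–(136) p. 298 and [Balaban1984PropagatorsI] p. 36 (the `cosh`
# weight): **THE ORDER-ZERO PART `P = Δ′ + Q(U)†(a•Q(U)) − κ•𝒦` OF `A₀` CARRIES A `cosh`-WEIGHTED VALUE ROW TO A `cosh`-WEIGHTED ROW, AT EVERY CENTRE,
# WITH AN EXPLICIT CONSTANT — the `hPuv` binder of this lineage's (K53) `B9Eq326LocalPartDivergenceBlockLetter` ∕ (K55) `…SmallGauge` (the `hp` row of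
# (K41) §5 at `A₀`): `‖u(b)‖ ≤ N_u·W_y(b₋)` for all bonds ⟹ `‖(Pu)(b)‖ ≤ c_P·N_u·W_y(b₋)`,
# `c_P = p_K·e^{2θ} + k_Q·e^{θ·d·(3L−1)} + ‖κ‖·(d−1)·δ_𝒦·e^{2θ}`, `p_K = 768·|DirPair d|·M_τ·M_φ²·(‖η^d‖∕c₀)·‖η⁻¹‖²·δ`,
# `k_Q = |a|·(c₁∕c₀)·(M_φ′C_QM_φ)·2d·(M_φ′C_QM_φ)`, `C_Q = 1 + 50(d+1)α`** — composition BY NAME of (K47) `B9Eq326LocalPartZerothOrderWeightedRow` §4 (the row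
# of `P` from the rows of `Δ′`, `𝒦` and a DISPLAYED penalty row `N_Q`), (K51) `B9Eq316PenaltyLocalLetter.norm_penalty_QtorusW_apply_le_local` (the LOCAL letter
# of the penalty at `Q := QtorusW`, locality `d_m(B(b), B(b′)) ≤ 2`), (K47) §1 `weighted_row_of_local_letter`, and §1 below: the product-`cosh` weight's ratio
# across two sites is `≤ e^{θ·d·d_{Lm}(x,x′)}`, hence `≤ e^{θ·d·(3L−1)}` across blocks within coarse distance `2` (`B9Eq349BlockDistanceWeight.tdist_le_mul_tdist_blockCoord_add`)
# (successor memo `t4/b2b-balaban-t4-ne9-formalise-leaf-05/g85/STOREY-J-A0-MAP-g85.md` §2 `hp` row, §3 (b); t4-ne9-idea-1 L-g150-4 «the block-pair oscillation `E_B`»)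

statement-level skeleton of published theorems with citation tags; proofs where landed; nothing here is a claim about the Yang–Mills mass gap

CITATION HEADER (lean-in-tree rule).  Audit cell `pub-balaban`, sub-cell `t4`, BINDER row NE9; filed by NE9 crux-team LEAF PROVER 05
(`b2b-balaban-t4-ne9-formalise-leaf-05`, gen 86).  Imports this lineage's (K47) `B9Eq326LocalPartZerothOrderWeightedRow` and (K51) `B9Eq316PenaltyLocalLetter`,
(K38) `B9Eq342GradientRowNaturalPerturbation` (`weight_site_shift_le` ∕ `weight_site_unshift_le`), and the NE9 OWNER's `B9Eq342CoshWeightBlockDistance`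
(`prod_cosh_torCast_eq`; through it `B9Eq349BlockDistanceWeight`, `B4Sect5Torus.ccoord_triangle`).  SOURCE READ first-hand in the held text layer
[Balaban1985BackgroundPropagators] (`paper:balaban1985-cmp99-background-propagators`): p. 395 (3.26); p. 404 (3.69); p. 393 (3.16); p. 392 (3.10)–(3.11);
[Balaban1985Variational] p. 298 (134)–(136); [Balaban1984PropagatorsI] p. 36.  [folklore] composition; nothing printed is a hypothesis; the `[cite: …]` tags are
TEXT LOCATIONS.

WHAT IS PROVED (sorry-free; 0 `def`; [folklore]).
* §1 **`prod_cosh_le_exp_mul_prod_cosh`** — on any torus `TSite d P`, `0 ≤ θ`: `W_y(x′) ≤ e^{θ·d·d_P(x,x′)}·W_y(x)` for the product weight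
  `W_y(x) = Π_μ cosh(θ·|y_μ − x_μ|∘)` (`cosh u′ ≤ e^{|u′−u|}cosh u` per coordinate, the coordinate triangle inequality, `|·|∘ ≤ d_P`);
  **`prod_cosh_le_exp_mul_prod_cosh_of_blockNear`** — on the fine torus `T_{(L·m)}`: `d_m(πx, πx′) ≤ s` ⟹ `W_y(x′) ≤ e^{θ·d·(Ls + (L−1))}·W_y(x)`.
* §2 **`norm_penalty_apply_le_weighted`** — the penalty row: `‖u(b′)‖ ≤ N_u·W_y(b′₋)` for all `b′` ⟹ `‖((Q†(a•Q))u)(b)‖ ≤ k_Q·e^{θd(3L−1)}·N_u·W_y(b₋)`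
  ((K51) ∘ (K47) §1 with `near b b′ := d_m(B(b), B(b′)) ≤ 2`).
* §3 **`norm_zerothOrder_apply_le_weighted_cosh`** — the row of `P = Δ′ + Q†(a•Q) − κ•𝒦` in the `hPuv` shape of (K53)∕(K55): for every centre `y` and every
  `N_u ≥ 0`, the value row implies the `P`-row with the constant `c_P` above ((K47) §4 with `E := e^{θ}` from (K38), `N_Q` from §2).
HONEST SCOPE.  Composition only; the holonomy letter `δ_𝒦` of `𝒦` (`hHol`), the plaquette smallness `δ`, the (3.35)-type averaging data `hα1 hU1 hreg` and
the fibre data stay DISPLAYED (the model's letters); the single-bond letter `k_Q` is (K51)'s crude one (the sharp `≈ L^{−d}` smaller letter of t4-ne9-idea-1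
L-g150-7 is not used); nothing of [B9] Thm 3.1∕3.3∕3.11 is asserted, valued or discharged.  NOT NE9 (cell pub-balaban: NE9 NOT PRINTED ∕ NOT PROVED; «NE9 ⇐
the named binders»; row WALLED ON A MODEL (O-NE9-1; #5 UNRULED); spine PROVED 0∕9; rung (B)+1 on a finite T⁴ — NOT infinite volume, NOT mass gap, NOT Clay;
HONEST DEPENDENCY: continuum YM on T⁴ ⇐ BetaPertH ∧ nine spine estimates (0/9 proved); BetaPertH ⇐ (D1) ∧ (D4) ∧ CAP+tail; G-an2-4 gates asym, D1 and
NE2/3/4).  NEW file; nothing modified.  Net new unproved facts: 0.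
-/

noncomputable section

set_option autoImplicit false

open scoped InnerProductSpace BigOperators

namespace Literature.MathematicalPhysics.QuantumFieldTheory.Balaban1983to89.B9Eq326LocalPartZerothOrderCoshRow

open B4Sect5Torus (TSite tdist ccoord ccoord_triangle ccoord_symm tdist_nonneg)
open B4TorusKernel.MultiPeriod (circAbs)
open B9SectCLatticeCarrier (Bond DirPair shift unshift)
open B7Prop1Explicit (U1 Wcx boxVec mem_U1)
open B9Eq311L2Pairing (WL2)
open B11Eq103H1Complex (BondL2K)
open B9Eq310DeltaPrime (reHol imHol)
open B9Eq310HessianOperator (curvOp adTransportW)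
open B9Eq319QprimeTorus (fineP blockCoord)
open B9Eq315QTorus (perCfg cornerSite QtorusW)
open B9Eq326LocalPartKatoForm (weitzOpK)
open B9Eq326LocalPartZerothOrderWeightedRow (weighted_row_of_local_letter norm_zerothOrder_apply_le_weighted)
open B9Eq316PenaltyLocalLetter (norm_penalty_QtorusW_apply_le_local alpha_nonneg)
open B9Eq342GradientRowNaturalPerturbation (weight_site_shift_le weight_site_unshift_le)
open B9Eq342CoshWeightBlockDistance (prod_cosh_torCast_eq)
open B9Eq349BlockDistanceWeight (tdist_le_mul_tdist_blockCoord_add)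

/-! ## §1 The product-`cosh` weight across two sites -/

section Weight

variable {d : ℕ}

/-- **`W_y(x′) ≤ e^{θ·d·d_P(x,x′)}·W_y(x)`** for the product weight `W_y(x) = Π_μ cosh(θ·|y_μ − x_μ|∘)`, `0 ≤ θ`: per coordinate
`cosh(θc′) ≤ e^{θ|c′ − c|}·cosh(θc)` and `|c′ − c| ≤ |x_μ − x′_μ|∘ ≤ d_P(x, x′)` (the coordinate triangle inequality). [folklore]
[cite: Balaban1984PropagatorsI, p.36; Balaban1985BackgroundPropagators, (3.69) p.404] -/
theorem prod_cosh_le_exp_mul_prod_cosh {P : Fin d → ℕ} [∀ i, NeZero (P i)] {θ : ℝ} (hθ : 0 ≤ θ) (y x x' : TSite d P) :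
    (∏ μ, Real.cosh (θ * (circAbs (P μ) (ZMod.val (((y μ : ℕ) : ZMod (P μ)) - ((x' μ : ℕ) : ZMod (P μ)))) : ℝ))) ≤
      Real.exp (θ * (d : ℝ) * tdist P x x') * ∏ μ, Real.cosh (θ * (circAbs (P μ) (ZMod.val (((y μ : ℕ) : ZMod (P μ)) - ((x μ : ℕ) : ZMod (P μ)))) : ℝ)) := by
  have hP : ∀ i, 1 ≤ P i := fun i => Nat.one_le_iff_ne_zero.mpr (NeZero.ne (P i))
  -- the elementary `cosh u′ ≤ e^{|u′ − u|}·cosh u`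
  have hcosh : ∀ u u' : ℝ, Real.cosh u' ≤ Real.exp |u' - u| * Real.cosh u := fun u u' => by
    rw [Real.cosh_eq, Real.cosh_eq]
    have h1 : Real.exp u' ≤ Real.exp |u' - u| * Real.exp u := by
      rw [← Real.exp_add]; exact Real.exp_le_exp.2 (by linarith [le_abs_self (u' - u)])
    have h2 : Real.exp (-u') ≤ Real.exp |u' - u| * Real.exp (-u) := by
      rw [← Real.exp_add]; exact Real.exp_le_exp.2 (by linarith [neg_abs_le (u' - u)])
    have e : Real.exp |u' - u| * ((Real.exp u + Real.exp (-u)) / 2) = (Real.exp |u' - u| * Real.exp u + Real.exp |u' - u| * Real.exp (-u)) / 2 := by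
      ring
    rw [e]
    linarith
  rw [prod_cosh_torCast_eq θ y x', prod_cosh_torCast_eq θ y x]
  have key : ∀ i, Real.cosh (θ * (ccoord P y x' i : ℝ)) ≤ Real.exp (θ * tdist P x x') * Real.cosh (θ * (ccoord P y x i : ℝ)) := fun i => by
    refine (hcosh (θ * (ccoord P y x i : ℝ)) (θ * (ccoord P y x' i : ℝ))).trans (mul_le_mul_of_nonneg_right ?_ (Real.cosh_pos _).le)
    apply Real.exp_le_exp.2
    have h1 : (ccoord P y x' i : ℝ) ≤ (ccoord P y x i : ℝ) + (ccoord P x x' i : ℝ) := by exact_mod_cast ccoord_triangle hP y x x' i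
    have h2 : (ccoord P y x i : ℝ) ≤ (ccoord P y x' i : ℝ) + (ccoord P x x' i : ℝ) := by
      have h := ccoord_triangle hP y x' x i
      rw [ccoord_symm hP x' x i] at h
      exact_mod_cast h
    have h3 : (ccoord P x x' i : ℝ) ≤ tdist P x x' := by
      have h := B4Sect5Torus.circAbs_le_tdist hP x x' i
      rwa [← B4Sect5Torus.ccoord_cast hP x x' i, Int.cast_natCast] at h
    rw [← mul_sub, abs_mul, abs_of_nonneg hθ]
    exact mul_le_mul_of_nonneg_left ((abs_sub_le_iff.2 ⟨by linarith, by linarith⟩).trans h3) hθ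
  calc ∏ i, Real.cosh (θ * (ccoord P y x' i : ℝ)) ≤ ∏ i, (Real.exp (θ * tdist P x x') * Real.cosh (θ * (ccoord P y x i : ℝ))) :=
        Finset.prod_le_prod (fun i _ => (Real.cosh_pos _).le) fun i _ => key i
    _ = Real.exp (θ * tdist P x x') ^ d * ∏ i, Real.cosh (θ * (ccoord P y x i : ℝ)) := by
        rw [Finset.prod_mul_distrib, Finset.prod_const, Finset.card_univ, Fintype.card_fin]
    _ = Real.exp (θ * (d : ℝ) * tdist P x x') * ∏ i, Real.cosh (θ * (ccoord P y x i : ℝ)) := by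
        rw [← Real.exp_nat_mul]; ring_nf

variable {L : ℕ} [NeZero L] {m : Fin d → ℕ} [∀ i, NeZero (fineP L m i)]

/-- **ACROSS NEAR BLOCKS**: on the fine torus `T_{(L·m)}` (`1 ≤ m_i`), `d_m(πx, πx′) ≤ s` ⟹ `W_y(x′) ≤ e^{θ·d·(L·s + (L−1))}·W_y(x)` (§1 with
`d_{Lm}(x,x′) ≤ L·d_m(πx,πx′) + (L−1)`). [folklore] [cite: Balaban1985Averaging, (2) p.17; Balaban1985BackgroundPropagators, (3.69) p.404, (3.49) p.399] -/
theorem prod_cosh_le_exp_mul_prod_cosh_of_blockNear (hm : ∀ i, 1 ≤ m i) {θ : ℝ} (hθ : 0 ≤ θ) {s : ℝ} (y x x' : TSite d (fineP L m))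
    (hs : tdist m (blockCoord L m x) (blockCoord L m x') ≤ s) :
    (∏ μ, Real.cosh (θ * (circAbs (fineP L m μ) (ZMod.val (((y μ : ℕ) : ZMod (fineP L m μ)) - ((x' μ : ℕ) : ZMod (fineP L m μ)))) : ℝ))) ≤
      Real.exp (θ * (d : ℝ) * ((L : ℝ) * s + ((L : ℝ) - 1))) *
        ∏ μ, Real.cosh (θ * (circAbs (fineP L m μ) (ZMod.val (((y μ : ℕ) : ZMod (fineP L m μ)) - ((x μ : ℕ) : ZMod (fineP L m μ)))) : ℝ)) := by
  refine (prod_cosh_le_exp_mul_prod_cosh hθ y x x').trans (mul_le_mul_of_nonneg_right (Real.exp_le_exp.2 ?_)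
    (Finset.prod_nonneg fun μ _ => (Real.cosh_pos _).le))
  have h1 := tdist_le_mul_tdist_blockCoord_add (L := L) hm x x'
  have hL : (0 : ℝ) ≤ L := Nat.cast_nonneg L
  have h2 : tdist (fineP L m) x x' ≤ (L : ℝ) * s + ((L : ℝ) - 1) := h1.trans (by nlinarith)
  exact mul_le_mul_of_nonneg_left h2 (by positivity)

end Weight

/-! ## §2 The penalty row `Q(U)†(a•Q(U))` in the `cosh` currency, and §3 the row of `P` -/

section Penalty

variable {d : ℕ} (L : ℕ) [NeZero L] (m : Fin d → ℕ) [∀ i, NeZero (m i)] [∀ i, NeZero (fineP L m i)]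
  {𝔸 : Type*} [NormedRing 𝔸] [StarRing 𝔸] [NormedAlgebra ℂ 𝔸] [StarModule ℂ 𝔸] [CompleteSpace 𝔸] [NormOneClass 𝔸] (hL : 1 ≤ L)
  (U : Bond d (fineP L m) → 𝔸ˣ) {α : ℝ} (hα1 : α ≤ 1 / 64)
  (hU1 : ∀ (x : B7Prop1Explicit.Site d) (κ : Fin d), perCfg (fineP L m) U x κ ∈ U1 𝔸)
  (hreg : ∀ (y : TSite d m) (κ : Fin d) (r : Fin d → Fin L),
    ‖((Wcx L (perCfg (fineP L m) U) (cornerSite L y) κ (boxVec L r) : 𝔸ˣ) : 𝔸) - 1‖ ≤ α)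
  {W : Type*} [NormedAddCommGroup W] [InnerProductSpace ℂ W] [FiniteDimensional ℂ W] (φ : W ≃ₗ[ℂ] 𝔸) {c₀ c₁ : ℝ} [Fact (0 < c₀)] [Fact (0 < c₁)]
  {Mφ Mφ' : ℝ} (hMφ : 0 ≤ Mφ) (hφ : ∀ w, ‖φ w‖ ≤ Mφ * ‖w‖) (hMφ' : 0 ≤ Mφ') (hφ' : ∀ X, ‖φ.symm X‖ ≤ Mφ' * ‖X‖)
  (hm : ∀ i, 1 ≤ m i) {θ : ℝ} (hθ : 0 ≤ θ)

omit [StarRing 𝔸] [StarModule ℂ 𝔸] in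
include hMφ hφ hMφ' hφ' hm hθ in
/-- **THE PENALTY ROW IN THE `cosh` CURRENCY**: `‖u(b′)‖ ≤ N_u·W_y(b′₋)` on every bond (`0 ≤ N_u`) ⟹
`‖((Q(U)†(a•Q(U)))u)(b)‖ ≤ k_Q·e^{θ·d·(3L−1)}·N_u·W_y(b₋)`, `k_Q = |a|·(c₁∕c₀)·(M_φ′C_QM_φ)·2d·(M_φ′C_QM_φ)`, `C_Q = 1 + 50(d+1)α` — (K51)'s local letter
(`d_m(B(b), B(b′)) ≤ 2`) through (K47) §1 with the block-pair ratio of §1 (`s = 2`). [folklore]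
[cite: Balaban1985BackgroundPropagators, (3.16) p.393, (3.26) p.395, (3.69) p.404; Balaban1984PropagatorsI, p.36] -/
theorem norm_penalty_apply_le_weighted (a : ℝ) (u : BondL2K ℂ d (fineP L m) c₀ W) (y : TSite d (fineP L m)) {Nu : ℝ} (hNu : 0 ≤ Nu)
    (hv : ∀ b : Bond d (fineP L m), ‖WL2.equiv ℂ (fun _ : Bond d (fineP L m) => c₀) W u b‖ ≤ Nu *
      (fun x : TSite d (fineP L m) =>
        ∏ μ, Real.cosh (θ * (circAbs (fineP L m μ) (ZMod.val (((y μ : ℕ) : ZMod (fineP L m μ)) - ((x μ : ℕ) : ZMod (fineP L m μ)))) : ℝ))) b.1)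
    (b : Bond d (fineP L m)) :
    ‖WL2.equiv ℂ (fun _ : Bond d (fineP L m) => c₀) W
        ((LinearMap.adjoint (QtorusW L m hL φ U hα1 hU1 hreg (c₀ := c₀) (c₁ := c₁)) ∘ₗ
          ((a : ℂ) • QtorusW L m hL φ U hα1 hU1 hreg (c₀ := c₀) (c₁ := c₁))) u) b‖ ≤
      |a| * (c₁ / c₀ * (Mφ' * (1 + 50 * (d + 1) * α) * Mφ) * ((2 * d : ℕ) : ℝ) * (Mφ' * (1 + 50 * (d + 1) * α) * Mφ)) *
        Real.exp (θ * (d : ℝ) * ((L : ℝ) * 2 + ((L : ℝ) - 1))) * Nu *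
        (fun x : TSite d (fineP L m) =>
          ∏ μ, Real.cosh (θ * (circAbs (fineP L m μ) (ZMod.val (((y μ : ℕ) : ZMod (fineP L m μ)) - ((x μ : ℕ) : ZMod (fineP L m μ)))) : ℝ))) b.1 := by
  refine weighted_row_of_local_letter
    (fun b => WL2.equiv ℂ (fun _ : Bond d (fineP L m) => c₀) W
      ((LinearMap.adjoint (QtorusW L m hL φ U hα1 hU1 hreg (c₀ := c₀) (c₁ := c₁)) ∘ₗ
        ((a : ℂ) • QtorusW L m hL φ U hα1 hU1 hreg (c₀ := c₀) (c₁ := c₁))) u) b)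
    (fun b => WL2.equiv ℂ (fun _ : Bond d (fineP L m) => c₀) W u b)
    (fun b : Bond d (fineP L m) => (fun x : TSite d (fineP L m) =>
      ∏ μ, Real.cosh (θ * (circAbs (fineP L m μ) (ZMod.val (((y μ : ℕ) : ZMod (fineP L m μ)) - ((x μ : ℕ) : ZMod (fineP L m μ)))) : ℝ))) b.1)
    (fun b b' : Bond d (fineP L m) => tdist m (blockCoord L m b.1) (blockCoord L m b'.1) ≤ 2) (Real.exp_pos _).le hNu
    (fun b => Finset.prod_nonneg fun μ _ => (Real.cosh_pos _).le) (fun b M hM hloc => ?_) hv (fun b b' hbb' => ?_) b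
  · have h := norm_penalty_QtorusW_apply_le_local L m hL U hα1 hU1 hreg φ (c₁ := c₁) hMφ hφ hMφ' hφ' hm a u b hM hloc
    exact h.trans (le_of_eq (by ring))
  · exact prod_cosh_le_exp_mul_prod_cosh_of_blockNear hm hθ y b.1 b'.1 hbb'

variable (τ : 𝔸 →ₗ[ℂ] ℂ) {Mτ : ℝ} (hτ : ∀ X Y : 𝔸, ‖τ (X * Y)‖ ≤ Mτ * ‖X‖ * ‖Y‖) (hMτ : 0 ≤ Mτ) (hstar : ∀ X : 𝔸, ‖star X‖ ≤ ‖X‖)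
  (η : ℝ) (hU : ∀ b, U b ∈ U1 𝔸) {δ : ℝ} (hδ : 0 ≤ δ)
  (hRe : ∀ p : B9SectCLatticeCarrier.Plaq d (fineP L m), ‖reHol U p - 1‖ ≤ δ) (hIm : ∀ p : B9SectCLatticeCarrier.Plaq d (fineP L m), ‖imHol U p‖ ≤ δ)

include hMφ hφ hMφ' hφ' hm hθ hτ hMτ hstar hU hδ hRe hIm in
/-- **THE ROW OF `P = Δ′ + Q(U)†(a•Q(U)) − κ•𝒦` IN THE `cosh` CURRENCY, `hPuv` SHAPE**: for every centre `y` and `N_u ≥ 0`, `‖u(b)‖ ≤ N_u·W_y(b₋)` on every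
bond ⟹ `‖(Pu)(b)‖ ≤ (c_P·N_u)·W_y(b₋)`, `c_P = p_K·e^{2θ} + k_Q·e^{θd(3L−1)} + ‖κ‖·(d−1)·δ_𝒦·e^{2θ}` — (K47) §4 with the one-step ratios `e^{θ}` of (K38),
the penalty row of §2, the holonomy letter `δ_𝒦` of `𝒦` displayed (transporters `R = Ad U`, `S = Ad U⁻¹`). [folklore]
[cite: Balaban1985BackgroundPropagators, (3.26) p.395, (3.69) p.404, (3.10)–(3.11) p.392, (3.16) p.393; Balaban1985Variational, (134)–(136) p.298] -/
theorem norm_zerothOrder_apply_le_weighted_cosh (a : ℝ) (κ : ℂ) {δK : ℝ} (hδK : 0 ≤ δK)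
    (hHol : ∀ (x : TSite d (fineP L m)) (μ ν : Fin d), μ ≠ ν → ∀ v : W,
      ‖adTransportW φ (fun b => (U b)⁻¹) (unshift ν x, ν) (adTransportW φ U (unshift ν x, μ) v) -
        adTransportW φ U (x, μ) (adTransportW φ (fun b => (U b)⁻¹) (shift μ (unshift ν x), ν) v)‖ ≤ δK * ‖v‖)
    (u : BondL2K ℂ d (fineP L m) c₀ W) (y : TSite d (fineP L m)) (Nu : ℝ) (hNu : 0 ≤ Nu)
    (hv : ∀ b : Bond d (fineP L m), ‖WL2.equiv ℂ (fun _ : Bond d (fineP L m) => c₀) W u b‖ ≤ Nu *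
      (fun x : TSite d (fineP L m) =>
        ∏ μ, Real.cosh (θ * (circAbs (fineP L m μ) (ZMod.val (((y μ : ℕ) : ZMod (fineP L m μ)) - ((x μ : ℕ) : ZMod (fineP L m μ)))) : ℝ))) b.1)
    (b : Bond d (fineP L m)) :
    ‖WL2.equiv ℂ (fun _ : Bond d (fineP L m) => c₀) W
        ((curvOp φ τ η U + LinearMap.adjoint (QtorusW L m hL φ U hα1 hU1 hreg (c₀ := c₀) (c₁ := c₁)) ∘ₗ
            ((a : ℂ) • QtorusW L m hL φ U hα1 hU1 hreg (c₀ := c₀) (c₁ := c₁)) -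
          κ • weitzOpK ℂ c₀ (adTransportW φ U) (adTransportW φ fun b => (U b)⁻¹) :
          BondL2K ℂ d (fineP L m) c₀ W →ₗ[ℂ] BondL2K ℂ d (fineP L m) c₀ W) u) b‖ ≤
      ((768 * Fintype.card (DirPair d) * Mτ * Mφ ^ 2 * (‖((η : ℂ)) ^ d‖ / c₀) * ‖((η : ℂ))⁻¹‖ ^ 2 * δ * Real.exp θ ^ 2 +
          |a| * (c₁ / c₀ * (Mφ' * (1 + 50 * (d + 1) * α) * Mφ) * ((2 * d : ℕ) : ℝ) * (Mφ' * (1 + 50 * (d + 1) * α) * Mφ)) *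
            Real.exp (θ * (d : ℝ) * ((L : ℝ) * 2 + ((L : ℝ) - 1))) +
          ‖κ‖ * ((d - 1 : ℝ) * δK * Real.exp θ ^ 2)) * Nu) *
        (fun x : TSite d (fineP L m) =>
          ∏ μ, Real.cosh (θ * (circAbs (fineP L m μ) (ZMod.val (((y μ : ℕ) : ZMod (fineP L m μ)) - ((x μ : ℕ) : ZMod (fineP L m μ)))) : ℝ))) b.1 := by
  have hUn : ∀ b, ‖(U b : 𝔸)‖ ≤ 1 ∧ ‖(((U b)⁻¹ : 𝔸ˣ) : 𝔸)‖ ≤ 1 := fun b => mem_U1.1 (hU b)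
  have hSR : ∀ (b : Bond d (fineP L m)) (w : W), adTransportW φ (fun b => (U b)⁻¹) b (adTransportW φ U b w) = w := fun b w => by
    rw [B9Eq310HessianOperator.adTransportW_apply, B9Eq310HessianOperator.adTransportW_apply, LinearEquiv.apply_symm_apply, inv_inv]
    have h : (((U b)⁻¹ : 𝔸ˣ) : 𝔸) * ((U b : 𝔸) * φ w * ((U b)⁻¹ : 𝔸ˣ)) * (U b : 𝔸) = φ w := by
      rw [← mul_assoc, ← mul_assoc, Units.inv_mul, one_mul, mul_assoc, Units.inv_mul, mul_one]
    rw [h, LinearEquiv.symm_apply_apply]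
  have hRS : ∀ (b : Bond d (fineP L m)) (w : W), adTransportW φ U b (adTransportW φ (fun b => (U b)⁻¹) b w) = w := fun b w => by
    rw [B9Eq310HessianOperator.adTransportW_apply, B9Eq310HessianOperator.adTransportW_apply, LinearEquiv.apply_symm_apply, inv_inv]
    have h : (U b : 𝔸) * ((((U b)⁻¹ : 𝔸ˣ) : 𝔸) * φ w * (U b : 𝔸)) * (((U b)⁻¹ : 𝔸ˣ) : 𝔸) = φ w := by
      rw [← mul_assoc, ← mul_assoc, Units.mul_inv, one_mul, mul_assoc, Units.mul_inv, mul_one]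
    rw [h, LinearEquiv.symm_apply_apply]
  have hQ := fun b' => norm_penalty_apply_le_weighted L m hL U hα1 hU1 hreg φ (c₁ := c₁) hMφ hφ hMφ' hφ' hm hθ a u y hNu hv b'
  have h := norm_zerothOrder_apply_le_weighted φ hφ hMφ hstar τ hτ hMτ η U hUn hδ hRe hIm
    (QtorusW L m hL φ U hα1 hU1 hreg (c₀ := c₀) (c₁ := c₁)) a κ (adTransportW φ U) (adTransportW φ fun b => (U b)⁻¹) hSR hRS hδK hHol u
    (fun x : TSite d (fineP L m) =>
      ∏ μ, Real.cosh (θ * (circAbs (fineP L m μ) (ZMod.val (((y μ : ℕ) : ZMod (fineP L m μ)) - ((x μ : ℕ) : ZMod (fineP L m μ)))) : ℝ)))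
    (E := Real.exp θ) (Real.one_le_exp hθ) hNu (fun x => Finset.prod_nonneg fun μ _ => (Real.cosh_pos _).le)
    (fun x ν => weight_site_shift_le hθ y x ν) (fun x ν => weight_site_unshift_le hθ y x ν) hv hQ b.1 b.2
  exact h.trans (le_of_eq (by ring))

end Penalty

end Literature.MathematicalPhysics.QuantumFieldTheory.Balaban1983to89.B9Eq326LocalPartZerothOrderCoshRow

end
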